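import Summits.CriticalPhenomena.PercolationContinuityZ3.Theorems.PercNearOneGluingNoHeavyLowerTailCombRowsLeFive
import HarnessLib

/-!
# The sharpened three-point row `Var(1_{abc}) ≤ P(ac|b) + P(bc|a) + 2·P(abc)·P(ab|c)` on every weighted graph with at most five vertices

Support file for crux `stmt-CriticalPhenomena-4575` (`NoHeavyLowerTail`), seat `prim-l12-p1` gen 19 (`--supports stmt-CriticalPhenomena-4575`;
COMPUTATIONAL: three `checkC` evaluations use `native_decide`).  Memo `run/shared/lean/prim/prim-l12/FROM-prim-l12-p1-g19-COMB-PLUS.md`.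

Bond percolation `μ = prodBernoulli w` with arbitrary edge weights on `Fin n`, three distinct vertices `a b c`; cells `x = P(abc)`, `s = P(ab|c)`,
`t = P(ac|b)`, `u = P(bc|a)`, `q = P(a|b|c)`.  Gen 19 isolates the FIBRE inequality

  `(COMB+)   N(abc, sep) ≤ N(abc, ab|c) + N(U', ¬abc)`   (`N(X,Y)` = number of 2-colourings of a multigraph with colour-1 pattern `X`, colour-2 pattern `Y`;
  `U' = {ac|b, bc|a}`), verified on every multigraph with `≤ 6` vertices and `≤ 9` edges and on every multigraph with `≤ 5` vertices and `≤ 10` edges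
  (0 violations); its law-level shadow is THE NEW ROW

  `(3PT+)   x·(1 − x) ≤ t + u + 2·x·s`,   equivalently   `x·q ≤ x·s + (t+u)·(1 − x)`,

which is the transport form of the three-point variance row `(3PT)` `θ(1−θ) ≤ s+t+u` (θ = x+s) with the slack `s²` removed: `(3PT) = (3PT+) + s²`, so
`(3PT+) ⟹ (3PT)` at the law level and `(COMB+) ⟹` two-copy comb positivity of `(3PT)`.  THIS FILE proves `(3PT+)` for every `n ≤ 5`, every weight vector and
all pairwise distinct `a b c`, by prim-bnk-1's generic packaging `CombRows.tri_cval_le_five`: the four-term family `plusTerms` is relabelling-equivariant (`rfl`)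
and passes prim-cert-2's comb checker `checkC` at the standard triple of `K₃`, `K₄`, `K₅`.  Nothing is claimed here beyond five vertices.

Main results: `plus_cval_le_five` (term form), `threePointPlus_le_five` (the displayed inequality in `openConn` notation),
`threePointVariance_of_plus` (the algebra `(3PT+) ⟹ (3PT)`, all `n`).
-/

namespace Summit.CriticalPhenomena.PercolationContinuityZ3.Theorems.ThreePointPlus

open Finset MeasureTheory OneCutCert CovTransferCert E3GroupSepCert CombRows
open scoped BigOperators
open Literature.Probability.Percolation Literature.Probability.LatticeModels

variable {n : ℕ}

/-- The event `¬(a ↔ b ∧ a ↔ c)` (the three terminals are not all joined). [this work] -/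
def pNT (a b c : Fin n) : CRel n → Bool := fun r => !(r a b && r a c)

/-- The four signed terms of `(3PT+)` (right side minus left side; unused factors `pTrue`):
`P(ac|b)·1·1 + P(bc|a)·1·1 + 2·P(abc)·P(ab|c)·1 − P(abc)·P(¬abc)·1`. [this work] -/
def plusTerms (n : ℕ) (t : Tri n) : List (CTerm n) :=
  let a := t.1
  let b := t.2.1
  let c := t.2.2
  [((1 : ℤ), pU₂ a b c, pTrue, pTrue), ((1 : ℤ), pU₃ a b c, pTrue, pTrue), ((2 : ℤ), pT a b c, pU₁ a b c, pTrue),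
    ((-1 : ℤ), pT a b c, pNT a b c, pTrue)]

/-- The family commutes with vertex relabellings. [this work] -/
theorem plusTerms_equivariant : TriEquivariant plusTerms := by
  intro n τ t
  obtain ⟨a, b, c⟩ := t
  rfl

/-- `K₃` check (base `2^14`). [this work] -/
theorem checkPlus3 : checkC 3 14 (plusTerms 3 (tri₀ 3 le_rfl)) = true := by native_decide

/-- `K₄` check (base `2^23`). [this work] -/
theorem checkPlus4 : checkC 4 23 (plusTerms 4 (tri₀ 4 (by norm_num))) = true := by native_decide

/-- `K₅` check (base `2^35`). [this work] -/
theorem checkPlus5 : checkC 5 35 (plusTerms 5 (tri₀ 5 (by norm_num))) = true := by native_decide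

/-- **`(3PT+)` (term form) on every weighted graph with at most five vertices.** [this work] -/
theorem plus_cval_le_five : ∀ n ≤ 5, ∀ (w : Sym2 (Fin n) → unitInterval) (a b c : Fin n),
    a ≠ b → a ≠ c → b ≠ c → 0 ≤ cval w (plusTerms n (a, b, c)) :=
  tri_cval_le_five plusTerms_equivariant checkPlus3 checkPlus4 checkPlus5

/-- `¬abc` in `openConn` notation. [this work] -/
theorem connEvent_pNT (a b c : Fin n) : connEvent (pNT a b c) = (openConn a b ∩ openConn a c)ᶜ := by
  ext ω
  simp only [connEvent, pNT, Set.mem_setOf_eq, Set.mem_compl_iff, Set.mem_inter_iff, Bool.not_eq_true',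
    Bool.and_eq_false_iff, decide_eq_false_iff_not, not_and_or]

/-- **The sharpened three-point row on every weighted graph with at most five vertices**: for `n ≤ 5`, every `w` and all pairwise distinct
`a b c : Fin n`,  `P(abc)·P(¬abc) ≤ P(ac|b) + P(bc|a) + 2·P(abc)·P(ab|c)`. [this work] -/
theorem threePointPlus_le_five (hn : n ≤ 5) (w : Sym2 (Fin n) → unitInterval) (a b c : Fin n) (hab : a ≠ b) (hac : a ≠ c)
    (hbc : b ≠ c) :
    (prodBernoulli w).real (openConn a b ∩ openConn a c) * (prodBernoulli w).real (openConn a b ∩ openConn a c)ᶜ ≤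
      (prodBernoulli w).real (openConn a c ∩ (openConn a b)ᶜ) + (prodBernoulli w).real (openConn b c ∩ (openConn a b)ᶜ) +
        2 * (prodBernoulli w).real (openConn a b ∩ openConn a c) * (prodBernoulli w).real (openConn a b ∩ (openConn a c)ᶜ) := by
  have h := plus_cval_le_five n hn w a b c hab hac hbc
  unfold plusTerms cval at h
  simp only [List.map_cons, List.map_nil, List.sum_cons, List.sum_nil, pr_pTrue] at h
  unfold pr at h
  rw [connEvent_pU₁, connEvent_pU₂, connEvent_pU₃, connEvent_pT, connEvent_pNT] at h
  push_cast at h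
  linarith

/-- **`(3PT+) ⟹ (3PT)` (pure algebra, every `n`)**: with `x = P(abc)`, `s = P(ab|c)`, `t = P(ac|b)`, `u = P(bc|a)` and `P(a↔b) = x + s`,
`P(¬abc) = 1 − x`, the sharpened row `x(1−x) ≤ t+u+2xs` gives the variance row `(x+s)(1−x−s) ≤ s+t+u` (the difference is `s² ≥ 0`). [this work] -/
theorem threePointVariance_of_plus {x s t u : ℝ} (h : x * (1 - x) ≤ t + u + 2 * x * s) :
    (x + s) * (1 - (x + s)) ≤ s + t + u := by
  nlinarith [sq_nonneg s]

end Summit.CriticalPhenomena.PercolationContinuityZ3.Theorems.ThreePointPlus
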